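import Literature.Combinatorics.SimpleGraph.ColoringNoEdgeInversion       -- ★ row 30: `NoInversion.*`; brings ★ `TreeAutomorphismFixedPoints` ⊇ ★ `GraphAutomorphismsOneForms` (`orientSign`, `mapEdgeSet_mul`, `coe_mapEdgeSet`, `head_tail_mapEdgeSet`) ⊇ ★ `OrientedIncidenceMatrix` (`Orientation`, `incMatrix`)
import HarnessLib

/-!
# Invariant orientations: a group acts on a graph without inversion iff some orientation is preserved; colour- or order-models carry a CANONICAL invariant
# orientation, along which the incidence matrix is equivariant (Serre, *Trees*, I.3.1; Godsil–Royle §8.3; Schneider–Stuhler 1997, III.4)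

Topic `Combinatorics/SimpleGraph`; namespace `Literature.Combinatorics.SimpleGraph.NoInversion` (★ row 30's).  THEOREMS ONLY (no definition, no instance, no notation,
no named fact, no `sorry`), for ARBITRARY vertex types.  E1 BRICK LEDGER row 30b (keeper F0P3a-p03 (g29) «=» 2026-09-03T01:25:37Z); consumer: the oriented cellular chain
complex of the Bruhat–Tits tree of `U(Φ₃)` as a complex of `Γ`-MODULES (★ row 34 `SchneiderStuhlerTreeExactness` takes ANY `σ : Orientation G`; with an invariant `σ` its
boundary `u ↦ Σ_e D_{ue} • c e` is `Γ`-equivariant, §3).  HONEST LABEL: count-neutral generic base layer; HC_CM is proved only modulo the 2 remaining named inputs (hLiu418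
24832, h413 24833) until rung 0 closes.

THE MATHEMATICS (Serre I.3.1: «`G` opère sans inversion» ⟺ «il existe une orientation de `X` invariante par `G`»).  An ORIENTATION (★ `OrientedIncidence.Orientation`: a head for
every edge) is INVARIANT under an automorphism `φ` when `head (φ·e) = φ (head e)` for every edge `e` — i.e. ★ `orientSign σ K φ e = 1` everywhere.  (⟸, §4) an invariant
orientation forbids inversions: `φ·e = e` then forces `φ` to fix both ends.  (⟹, §5) if a group `Γ` acts (through `a : Γ →* (G ≃g G)`) WITHOUT INVERSION, choose one edge
`e₀` in every `Γ`-orbit and any head for it, and transport: `head (g·e₀) := g (head e₀)` is well defined exactly because the stabiliser of `e₀` fixes its ends.  In the two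
MODELS of ★ row 30 no choice is needed (§1–§2): a proper colouring into a LINEAR ORDER (orient towards the larger colour) or a vertex preorder in which adjacent vertices are
strictly comparable (orient towards the larger vertex — the lattice model: small lattice → big lattice) gives a CANONICAL orientation, unique, and invariant under every
colour-preserving (resp. strictly monotone) automorphism; §3 reads this as `ε_φ ≡ 1` and `D_{φu, φe} = D_{ue}`.

* §0 core over a relation `r` on the ends of edges: `exists_orientation_rel`, `orientation_head_eq_of_rel` (uniqueness), `head_mapEdgeSet_eq_of_rel` (invariance).
* §1 (C) colourings `[LinearOrder ι] (C : G.Coloring ι)`: **`exists_orientation_lt_of_coloring`**, `orientation_eq_of_coloring`, **`head_mapEdgeSet_eq_of_coloring`**.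
* §2 (O) orders `[Preorder V]`, `G.Adj x y → x < y ∨ y < x`: `exists_orientation_lt_of_adj`, `orientation_eq_of_lt`, `head_mapEdgeSet_eq_of_strictMono`.
* §3 consequences of invariance `hσφ : ∀ e, σ.head (φ.mapEdgeSet e) = φ (σ.head e)`: `tail_mapEdgeSet_eq_of_head_mapEdgeSet_eq`, `orientSign_eq_one_of_head_mapEdgeSet_eq`,
  **`incMatrix_map_mapEdgeSet_of_head_mapEdgeSet_eq`** (`D_{φu, φe} = D_{ue}`, any ring), and the (C)-specialisations `orientSign_eq_one_of_coloring`, `incMatrix_map_mapEdgeSet_of_coloring`.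
* §4 Serre ⟸: **`apply_eq_of_mapEdgeSet_eq_of_head_mapEdgeSet_eq`** (an invariant orientation ⇒ every stabilised edge is fixed pointwise).
* §5 Serre ⟹ (group form): **`exists_invariant_orientation_of_forall_mapEdgeSet_eq`** and the `iff` `exists_invariant_orientation_iff`.

## References
* [Serre1980Trees] J.-P. Serre, *Trees* (1980), Ch. I §3.1 (inversions; «sans inversion» ⟺ invariant orientation), §2.1 (orientations).
* [GodsilRoyle2001] C. Godsil, G. Royle, *Algebraic Graph Theory* (2001), §8.3 (orientations and the incidence matrix `D`).
* [SchneiderStuhler1997] P. Schneider, U. Stuhler, *Representation theory and sheaves on the Bruhat–Tits building*, Publ. Math. IHÉS 85 (1997), III.4 (oriented chains, `ε_F`).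
-/

set_option autoImplicit false

open Set SimpleGraph
open Literature.Combinatorics.SimpleGraph.OrientedIncidence Literature.Combinatorics.SimpleGraph.BakerNorine

namespace Literature.Combinatorics.SimpleGraph.NoInversion

variable {V : Type*} {G : SimpleGraph V}

/-! ## §0 Core: orienting every edge along an edge-asymmetric, edge-total relation -/

section Core

variable (r : V → V → Prop)

/-- If a relation `r` is TOTAL on the two ends of every edge (`r x y ∨ r y x` for `G.Adj x y`), some orientation has `r (tail e) (head e)` for every edge (flip ★ `someOrientation`
where needed). [cite: GodsilRoyle2001, §8.3] [cite: Serre1980Trees, I.2.1] -/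
theorem exists_orientation_rel (htot : ∀ x y, G.Adj x y → r x y ∨ r y x) : ∃ σ : Orientation G, ∀ e, r (σ.tail e) (σ.head e) := by
  classical
  let σ₀ := someOrientation G
  let σ : Orientation G := ⟨fun e => if r (σ₀.tail e) (σ₀.head e) then σ₀.head e else σ₀.tail e, fun e => by
    split_ifs
    exacts [σ₀.head_mem e, σ₀.tail_mem e]⟩
  refine ⟨σ, fun e => ?_⟩
  by_cases h : r (σ₀.tail e) (σ₀.head e)
  · have hh : σ.head e = σ₀.head e := if_pos h
    have ht : σ.tail e = σ₀.tail e := (σ.eq_tail_of_mem (σ₀.tail_mem e) (by rw [hh]; exact (σ₀.head_ne_tail e).symm)).symm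
    rw [hh, ht]
    exact h
  · have hh : σ.head e = σ₀.tail e := if_neg h
    have ht : σ.tail e = σ₀.head e := (σ.eq_tail_of_mem (σ₀.head_mem e) (by rw [hh]; exact σ₀.head_ne_tail e)).symm
    rw [hh, ht]
    exact ((htot _ _ (σ₀.adj_head_tail e)).resolve_right h)

/-- UNIQUENESS: if `r` is ASYMMETRIC on the ends of every edge, two orientations with `r (tail e) (head e)` have the same heads. [cite: GodsilRoyle2001, §8.3] -/
theorem orientation_head_eq_of_rel (hasymm : ∀ x y, G.Adj x y → r x y → ¬ r y x) {σ σ' : Orientation G} (hσ : ∀ e, r (σ.tail e) (σ.head e))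
    (hσ' : ∀ e, r (σ'.tail e) (σ'.head e)) (e : G.edgeSet) : σ.head e = σ'.head e := by
  by_contra hne
  have h1 : σ.head e = σ'.tail e := σ'.eq_tail_of_mem (σ.head_mem e) hne
  have h2 : σ.tail e = σ'.head e := σ'.eq_head_of_mem (σ.tail_mem e) (by rw [← h1]; exact (σ.head_ne_tail e).symm)
  have h := hσ e
  rw [h1, h2] at h
  exact hasymm _ _ (σ'.adj_head_tail e).symm (hσ' e) h

/-- The same as an equality of orientations. [cite: GodsilRoyle2001, §8.3] -/
theorem orientation_eq_of_rel (hasymm : ∀ x y, G.Adj x y → r x y → ¬ r y x) {σ σ' : Orientation G} (hσ : ∀ e, r (σ.tail e) (σ.head e))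
    (hσ' : ∀ e, r (σ'.tail e) (σ'.head e)) : σ = σ' := by
  have h : σ.head = σ'.head := funext fun e => orientation_head_eq_of_rel r hasymm hσ hσ' e
  rcases σ with ⟨h₁, m₁⟩
  rcases σ' with ⟨h₂, m₂⟩
  change h₁ = h₂ at h
  subst h
  rfl

/-- INVARIANCE: if `r` is asymmetric on edges and `φ : G ≃g G` carries `r` on edges to `r` (`G.Adj x y → r x y → r (φ x) (φ y)`), an orientation with `r (tail e) (head e)`
is preserved by `φ`: `head (φ·e) = φ (head e)` and `tail (φ·e) = φ (tail e)`. [cite: Serre1980Trees, I.3.1] -/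
theorem head_mapEdgeSet_eq_of_rel (hasymm : ∀ x y, G.Adj x y → r x y → ¬ r y x) (φ : G ≃g G) (hφ : ∀ x y, G.Adj x y → r x y → r (φ x) (φ y))
    {σ : Orientation G} (hσ : ∀ e, r (σ.tail e) (σ.head e)) (e : G.edgeSet) :
    σ.head (φ.mapEdgeSet e) = φ (σ.head e) ∧ σ.tail (φ.mapEdgeSet e) = φ (σ.tail e) := by
  rcases head_tail_mapEdgeSet σ φ e with h | ⟨h1, h2⟩
  · exact h
  · exfalso
    have h := hσ (φ.mapEdgeSet e)
    rw [h1, h2] at h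
    exact hasymm _ _ (φ.map_adj_iff.2 (σ.adj_head_tail e)).symm (hφ _ _ (σ.adj_head_tail e).symm (hσ e)) h

end Core

/-! ## §1 (C) Proper colourings into a linear order: orient towards the larger colour -/

section Coloring

variable {ι : Type*} [LinearOrder ι] (C : G.Coloring ι)

/-- **A proper colouring into a linear order orients the graph**: some orientation has `C (tail e) < C (head e)` on every edge. [cite: GodsilRoyle2001, §8.3] [cite: Serre1980Trees, I.2.1] -/
theorem exists_orientation_lt_of_coloring : ∃ σ : Orientation G, ∀ e, C (σ.tail e) < C (σ.head e) :=
  exists_orientation_rel (fun x y => C x < C y) fun _ _ h => lt_or_gt_of_ne (C.valid h)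

/-- … and that orientation is unique. [cite: GodsilRoyle2001, §8.3] -/
theorem orientation_eq_of_coloring {σ σ' : Orientation G} (hσ : ∀ e, C (σ.tail e) < C (σ.head e)) (hσ' : ∀ e, C (σ'.tail e) < C (σ'.head e)) : σ = σ' :=
  orientation_eq_of_rel (fun x y => C x < C y) (fun _ _ _ h => lt_asymm h) hσ hσ'

/-- **The colour orientation is preserved by every colour-preserving automorphism**: `head (φ·e) = φ (head e)`, `tail (φ·e) = φ (tail e)`. [cite: Serre1980Trees, I.3.1] -/
theorem head_mapEdgeSet_eq_of_coloring {σ : Orientation G} (hσ : ∀ e, C (σ.tail e) < C (σ.head e)) (φ : G ≃g G) (hC : ∀ v, C (φ v) = C v) (e : G.edgeSet) :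
    σ.head (φ.mapEdgeSet e) = φ (σ.head e) ∧ σ.tail (φ.mapEdgeSet e) = φ (σ.tail e) :=
  head_mapEdgeSet_eq_of_rel (fun x y => C x < C y) (fun _ _ _ h => lt_asymm h) φ (fun x y _ h => by rw [hC, hC]; exact h) hσ e

end Coloring

/-! ## §2 (O) Vertex preorders with strictly comparable adjacent vertices: orient towards the larger vertex -/

section Order

variable [Preorder V]

/-- If adjacent vertices are strictly comparable, some orientation has `tail e < head e` on every edge (lattice models: small lattice → big lattice). [cite: Serre1980Trees, I.2.1]
[cite: GodsilRoyle2001, §8.3] -/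
theorem exists_orientation_lt_of_adj (hadj : ∀ x y, G.Adj x y → x < y ∨ y < x) : ∃ σ : Orientation G, ∀ e, σ.tail e < σ.head e :=
  exists_orientation_rel (· < ·) hadj

/-- … unique. [cite: GodsilRoyle2001, §8.3] -/
theorem orientation_eq_of_lt {σ σ' : Orientation G} (hσ : ∀ e, σ.tail e < σ.head e) (hσ' : ∀ e, σ'.tail e < σ'.head e) : σ = σ' :=
  orientation_eq_of_rel (· < ·) (fun _ _ _ h => lt_asymm h) hσ hσ'

/-- **The order orientation is preserved by every automorphism that is strictly monotone on edges.** [cite: Serre1980Trees, I.3.1] -/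
theorem head_mapEdgeSet_eq_of_strictMono {σ : Orientation G} (hσ : ∀ e, σ.tail e < σ.head e) (φ : G ≃g G) (hφ : ∀ x y, G.Adj x y → x < y → φ x < φ y) (e : G.edgeSet) :
    σ.head (φ.mapEdgeSet e) = φ (σ.head e) ∧ σ.tail (φ.mapEdgeSet e) = φ (σ.tail e) :=
  head_mapEdgeSet_eq_of_rel (· < ·) (fun _ _ _ h => lt_asymm h) φ hφ hσ e

end Order

/-! ## §3 Consequences of invariance: tails, `ε_φ ≡ 1`, equivariance of the incidence matrix -/

section Invariant

variable (σ : Orientation G) (φ : G ≃g G)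

/-- If `φ` preserves heads it preserves tails. [cite: GodsilRoyle2001, §8.3] -/
theorem tail_mapEdgeSet_eq_of_head_mapEdgeSet_eq (hσφ : ∀ e, σ.head (φ.mapEdgeSet e) = φ (σ.head e)) (e : G.edgeSet) : σ.tail (φ.mapEdgeSet e) = φ (σ.tail e) := by
  rcases head_tail_mapEdgeSet σ φ e with ⟨-, h⟩ | ⟨h1, -⟩
  · exact h
  · exact absurd ((hσφ e).symm.trans h1) fun h => σ.head_ne_tail e (φ.injective h)

/-- Invariance read as ★ `orientSign ≡ 1`. [cite: SchneiderStuhler1997, III.4] -/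
theorem orientSign_eq_one_of_head_mapEdgeSet_eq [DecidableEq V] (K : Type*) [Field K] (hσφ : ∀ e, σ.head (φ.mapEdgeSet e) = φ (σ.head e)) (e : G.edgeSet) : orientSign σ K φ e = 1 :=
  orientSign_of_head_eq σ K (hσφ e)

/-- **EQUIVARIANCE OF THE INCIDENCE MATRIX along an invariant orientation**: `D_{φ u, φ·e} = D_{u e}` (any ring) — the boundary `c ↦ (u ↦ Σ_e D_{ue} • c e)` commutes with `φ`.
[cite: GodsilRoyle2001, §8.3] [cite: SchneiderStuhler1997, III.4] -/
theorem incMatrix_map_mapEdgeSet_of_head_mapEdgeSet_eq (R : Type*) [Ring R] [DecidableEq V] (hσφ : ∀ e, σ.head (φ.mapEdgeSet e) = φ (σ.head e)) (u : V) (e : G.edgeSet) :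
    σ.incMatrix R (φ u) (φ.mapEdgeSet e) = σ.incMatrix R u e := by
  simp only [σ.incMatrix_apply R, hσφ e, tail_mapEdgeSet_eq_of_head_mapEdgeSet_eq σ φ hσφ e, φ.injective.eq_iff]

variable {σ} {ι : Type*} [LinearOrder ι] (C : G.Coloring ι)

/-- (C): along the colour orientation every colour-preserving automorphism has `ε_φ ≡ 1`. [cite: SchneiderStuhler1997, III.4] [cite: Serre1980Trees, I.3.1] -/
theorem orientSign_eq_one_of_coloring [DecidableEq V] (K : Type*) [Field K] (hσ : ∀ e, C (σ.tail e) < C (σ.head e)) (hC : ∀ v, C (φ v) = C v) (e : G.edgeSet) : orientSign σ K φ e = 1 :=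
  orientSign_eq_one_of_head_mapEdgeSet_eq σ φ K (fun e => (head_mapEdgeSet_eq_of_coloring C hσ φ hC e).1) e

/-- **(C): along the colour orientation the incidence matrix is equivariant under every colour-preserving automorphism**, `D_{φ u, φ·e} = D_{u e}`.
[cite: GodsilRoyle2001, §8.3] [cite: SchneiderStuhler1997, III.4] -/
theorem incMatrix_map_mapEdgeSet_of_coloring (R : Type*) [Ring R] [DecidableEq V] (hσ : ∀ e, C (σ.tail e) < C (σ.head e)) (hC : ∀ v, C (φ v) = C v) (u : V)
    (e : G.edgeSet) : σ.incMatrix R (φ u) (φ.mapEdgeSet e) = σ.incMatrix R u e :=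
  incMatrix_map_mapEdgeSet_of_head_mapEdgeSet_eq σ φ R (fun e => (head_mapEdgeSet_eq_of_coloring C hσ φ hC e).1) u e

end Invariant

/-! ## §4 Serre I.3.1 (⟸): an invariant orientation forbids inversions -/

section SerreEasy

/-- **An automorphism preserving an orientation inverts no edge**: if `head (φ·e) = φ (head e)` for all `e` and `φ·e = e`, then `φ` fixes both ends of `e`.
[cite: Serre1980Trees, I.3.1] -/
theorem apply_eq_of_mapEdgeSet_eq_of_head_mapEdgeSet_eq (σ : Orientation G) (φ : G ≃g G) (hσφ : ∀ e, σ.head (φ.mapEdgeSet e) = φ (σ.head e)) {e : G.edgeSet}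
    (he : φ.mapEdgeSet e = e) : ∀ v ∈ (e : Sym2 V), φ v = v := by
  have hh : φ (σ.head e) = σ.head e := by rw [← hσφ e, he]
  have ht : φ (σ.tail e) = σ.tail e := by rw [← tail_mapEdgeSet_eq_of_head_mapEdgeSet_eq σ φ hσφ e, he]
  intro v hv
  rcases σ.mem_iff.1 hv with rfl | rfl
  exacts [hh, ht]

end SerreEasy

/-! ## §5 Serre I.3.1 (⟹): a group acting without inversion preserves some orientation -/

section SerreHard

variable {Γ : Type*} [Group Γ] (a : Γ →* (G ≃g G))

/-- **SERRE I.3.1: a group acting on a graph WITHOUT INVERSION preserves some orientation.**  Hypothesis: whenever `g·e = e`, `g` fixes both ends of `e`; conclusion: an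
orientation with `head (g·e) = g (head e)` for all `g`, `e` (choose a head in one edge of each orbit and transport — well defined because edge stabilisers fix ends).
[cite: Serre1980Trees, I.3.1] -/
theorem exists_invariant_orientation_of_forall_mapEdgeSet_eq (hno : ∀ (g : Γ) (e : G.edgeSet), (a g).mapEdgeSet e = e → ∀ v ∈ (e : Sym2 V), a g v = v) :
    ∃ σ : Orientation G, ∀ (g : Γ) (e : G.edgeSet), σ.head ((a g).mapEdgeSet e) = a g (σ.head e) := by
  classical
  -- orbits and a choice of representative, constant along orbits
  let orb : G.edgeSet → Set G.edgeSet := fun e => {e' | ∃ g : Γ, (a g).mapEdgeSet e = e'}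
  have hinv : ∀ (g : Γ) (e : G.edgeSet), (a g⁻¹).mapEdgeSet ((a g).mapEdgeSet e) = e := fun g e => by
    rw [← mapEdgeSet_mul, ← map_mul, inv_mul_cancel, map_one, mapEdgeSet_one]
  have horb : ∀ (g : Γ) (e : G.edgeSet), orb ((a g).mapEdgeSet e) = orb e := by
    intro g e
    ext e'
    constructor
    · rintro ⟨h, rfl⟩
      exact ⟨h * g, by rw [map_mul, mapEdgeSet_mul]⟩
    · rintro ⟨h, rfl⟩
      exact ⟨h * g⁻¹, by rw [map_mul, mapEdgeSet_mul, hinv]⟩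
  obtain hE | hE := isEmpty_or_nonempty G.edgeSet
  · exact ⟨someOrientation G, fun g e => (IsEmpty.false e).elim⟩
  let rep : G.edgeSet → G.edgeSet := fun e => Classical.epsilon fun x => x ∈ orb e
  have hrep_mem : ∀ e, rep e ∈ orb e := fun e => Classical.epsilon_spec (p := fun x => x ∈ orb e) ⟨e, 1, by rw [map_one, mapEdgeSet_one]⟩
  have hrep : ∀ (g : Γ) (e : G.edgeSet), rep ((a g).mapEdgeSet e) = rep e := fun g e => by
    show Classical.epsilon (fun x => x ∈ orb ((a g).mapEdgeSet e)) = Classical.epsilon (fun x => x ∈ orb e)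
    rw [horb]
  -- a transporter `t e` with `(a (t e))·(rep e) = e`
  have htr : ∀ e : G.edgeSet, ∃ g : Γ, (a g).mapEdgeSet (rep e) = e := fun e => by
    obtain ⟨g, hg⟩ := hrep_mem e
    exact ⟨g⁻¹, by rw [← hg, hinv]⟩
  choose t ht using htr
  -- KEY: two transporters of `rep e` to the same edge agree on the ends of `rep e`
  have hwd : ∀ (e : G.edgeSet) (g h : Γ), (a g).mapEdgeSet (rep e) = (a h).mapEdgeSet (rep e) → ∀ v ∈ ((rep e : G.edgeSet) : Sym2 V), a g v = a h v := by
    intro e g h hgh v hv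
    have hfix : (a (h⁻¹ * g)).mapEdgeSet (rep e) = rep e := by rw [map_mul, mapEdgeSet_mul, hgh, hinv]
    have hv' := hno (h⁻¹ * g) (rep e) hfix v hv
    rw [map_mul, map_inv] at hv'
    -- `hv' : (a h)⁻¹ * a g) v = v`
    have : (a h) (((a h)⁻¹ * a g) v) = (a h) v := by rw [hv']
    simpa using this
  let σ₀ := someOrientation G
  refine ⟨⟨fun e => a (t e) (σ₀.head (rep e)), fun e => ?_⟩, fun g e => ?_⟩
  · -- the transported head lies on `e = (a (t e))·(rep e)`
    have hmem : a (t e) (σ₀.head (rep e)) ∈ (((a (t e)).mapEdgeSet (rep e) : G.edgeSet) : Sym2 V) := by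
      rw [Iso.mapEdgeSet_apply, Hom.mapEdgeSet_coe]
      exact Sym2.mem_map.2 ⟨_, σ₀.head_mem _, rfl⟩
    rwa [ht e] at hmem
  · -- invariance: both `t (g·e)` and `g * t e` transport `rep e` to `g·e`
    show a (t ((a g).mapEdgeSet e)) (σ₀.head (rep ((a g).mapEdgeSet e))) = a g (a (t e) (σ₀.head (rep e)))
    rw [hrep g e]
    have h2 : (a (t ((a g).mapEdgeSet e))).mapEdgeSet (rep e) = (a (g * t e)).mapEdgeSet (rep e) := by
      rw [map_mul, mapEdgeSet_mul, ht e, ← hrep g e, ht]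
    have h3 := hwd e _ _ h2 (σ₀.head (rep e)) (σ₀.head_mem _)
    rw [h3, map_mul]
    rfl

/-- **SERRE I.3.1 as an `iff`**: a group acts without inversion iff it preserves some orientation. [cite: Serre1980Trees, I.3.1] -/
theorem exists_invariant_orientation_iff :
    (∃ σ : Orientation G, ∀ (g : Γ) (e : G.edgeSet), σ.head ((a g).mapEdgeSet e) = a g (σ.head e)) ↔
      ∀ (g : Γ) (e : G.edgeSet), (a g).mapEdgeSet e = e → ∀ v ∈ (e : Sym2 V), a g v = v := by
  refine ⟨?_, exists_invariant_orientation_of_forall_mapEdgeSet_eq a⟩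
  rintro ⟨σ, hσ⟩ g e he
  exact apply_eq_of_mapEdgeSet_eq_of_head_mapEdgeSet_eq σ (a g) (hσ g) he

end SerreHard

end Literature.Combinatorics.SimpleGraph.NoInversion
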